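import Summits.QuantumFields.BalabanUV.Beta.LagrangeFoldZero
import Summits.QuantumFields.BalabanUV.Beta.ValueHessianBlind
import Summits.QuantumFields.BalabanUV.Beta.CoDressedMmRead

/-!
# `BalabanUV.Beta.LagrangeFoldLiteral` — binder row D1, (L4) bookkeeping: ORDER-ONE CONSISTENCY OF THE Λ-SECTOR FOR THE LITERAL v2.26 SLOTS
# (straight conversion coefficients `lamCoeffK (KInvStep Lc j) (E2 j)` / `lamCoeffOf (KInv Lc)` read through the CO-DRESSED `G_j`): the mixed
# sandwich has the same multiplier block as the pure one, by the BLINDNESS of the value Hessian to the block-mean dressing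
# (β sub-cell, D1 formalisation swarm, unit `b2b-balaban-beta-d1-formalise-leaf-10`, gen 2; CLAIM «D1-L4-FOLD», part 4)

NOT IN PRINT; OUR BOOKKEEPING.  HONEST FRAMING (cell contract, verbatim): «discharging `BetaPertH` makes Bałaban's UV stability
UNCONDITIONAL — a real constructive-QFT result; it is NOT the continuum limit and NOT the Clay problem.»  HONEST DEPENDENCY (verbatim):
«continuum YM on T⁴ ⇐ BetaPertH ∧ nine spine estimates (0/9 proved); BetaPertH ⇐ (D1) ∧ (D4) ∧ CAP+tail; G-an2-4 gates asym, D1 and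
NE2/3/4.»  [folklore] kernel algebra; instantiates NO binder of the β-function wall; no `[cite:]`, no `def`, no `def … : Prop`; NOT D1,
NOT `BetaPertH`, NOT continuum, NOT Clay.

## What

Parts 2–3 (`LagrangeFoldStep`, `LagrangeFoldZero`) settle the Λ-fold for the slot typed THROUGH `G_j`.  The ADOPTED tables
(`WardLocusRecursive.SrecAt`, `SpineRootedS0N.S0NAt`) type the slot through the STRAIGHT resolvents (`KInvStep Lc (j+1)`, `KInv Lc`) while the
one-step kernel reads the vertex through the co-dressed `G = Πᵀ∘A∘Π` (`coDressKBmAt = trK piKBm ∘ · ∘ piKBm`).  §1 (generic): if the middle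
kernel `E` is BLIND to the dressing (`E ∘ Πᵀ = E`, and for the pure sandwich also `Π ∘ E = E`), then the multiplier blocks of the mixed
sandwich `A∘E∘G`, of the pure sandwich `G∘E∘G`, and of the straight sandwich `A∘E∘A` COINCIDE (associativity under tameness + `comp_piKBm_inr`,
`comp_trK_piKBm_inr`).  §2: an2's `ValueHessianBlind.comp_E2_trK_piKBm` / `comp_piKBm_E2` supply the blindness of `E2 (j+1)` ⇒
**`vertexOfK_lagrangePiece_literal_eq_vertexOfM`**: `vertexOfK G_{j+1} Lc (κ u ↦ c • SLam Lc (lamCoeffK (KInvStep Lc (j+1)) (E2 (j+1)) Lc) Q κ u) μ y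
= (c / wVH (j+1)) • vertexOfM G_{j+1} Lc Q μ y` and **`vertexOfK_lagrangePiece_literal_eq_M1At`** — the Λ-piece of `SrecAt (j+1)` EXACTLY AS
ADOPTED folds to `vertexOfM G_{j+1} Lc (M1At d Lc (toSite r) cΛ (j+1))`.  §3: `BorderedHessianBlind.comp_bhK_trK_piKBm` / `comp_piKBm_bhK`
give the blindness of the field block of `bhKAt` ⇒ the same at level `0` for `S0NAt`'s slot `lamCoeffOf (KInv Lc) Lc`
(**`vertexOfK_lagrangePiece_literal_zero_eq_M1At`**, via `KInvStep_zero_eq`).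

UPSHOT (for the owner's OPEN TYPING POINT (Λ-slot)): at order one the straight and the `G`-typed Λ-slots are INDISTINGUISHABLE through the
vertex — (c1) holds for the literal v2.26 tables with an2's `M1At` weights, no retyping needed.  Nothing else is claimed.
-/

noncomputable section

open Finset
open scoped BigOperators
open Literature.MathematicalPhysics.QuantumFieldTheory
open Literature.MathematicalPhysics.QuantumFieldTheory.Balaban1983to89
open Literature.MathematicalPhysics.QuantumFieldTheory.Balaban1983to89.Beta
open ExpKernelCalculus (MKer Decays comp)
open KernelWard (bdd_of_decays)
open AffineAveraging (box toSite)
open OneStepResolventKernel (Fib KInv decays_mono)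
open OneStepKernelFamily (KInvStep vertexOfK decays_KInvStep)
open InterLevelTransport (SLam cwsum cwsum_apply)
open BalabanStepJets (lamCoeffOf)
open BalabanStepJetsSucc (lamCoeffK E2 wVH wΛ decays_E2 decays_comp)
open BalabanStepW2 (wM1)
open SecondOrderResponse (colM vertexOfM)
open AveragingHessianKernelsRooted (hessFFAt)
open Summit.QuantumFields.BalabanUV.Beta.TameKernelCalculus
open Summit.QuantumFields.BalabanUV.Beta.ChartConjugationRelative (spr_comp)
open Summit.QuantumFields.BalabanUV.Beta.AxialDressingRooted (piKBm piKBm_inl_inr piKBm_inr_inl coDressKBmAt coDressKBmAt_eq comp_piKBm_inr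
  comp_trK_piKBm_inr spr_piKBm spr_trK_piKBm decays_coDressKBmAt_KInvStep one_le_of_neZero)
open Summit.QuantumFields.BalabanUV.Beta.BorderedHessian (bhK bhKAt bhKAt_inl_inl comp_bhK_trK_piKBm comp_piKBm_bhK decays_bhKAt
  comp_E2_trK_piKBm comp_piKBm_E2 KInvStep_zero_eq)
open Summit.QuantumFields.BalabanUV.Beta.SpineRooted (M1At)
open Summit.QuantumFields.BalabanUV.Beta.LagrangeFold (vertexOfK_smul_SLam_lamCoeffK)
open Summit.QuantumFields.BalabanUV.Beta.LagrangeFoldStep (colM_sandwich_E2 wVH_ne_zero wΛ_eq_wM1_mul_wVH)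
open Summit.QuantumFields.BalabanUV.Beta.LagrangeFoldZero (lamCoeffOf_eq_lamCoeffK colM_sandwich_zero wM1_zero)

namespace Summit.QuantumFields.BalabanUV.Beta.LagrangeFoldLiteral

variable {d : ℕ} {N : ℕ}

/-! ## §1 Multiplier blocks of mixed, pure and straight sandwiches coincide under blindness -/

section Generic

variable {ρ : Fin (d + 1) → ℤ} {A E : MKer (d + 1) (Fib d)}

/-- [folklore] **MIXED = STRAIGHT**: if `E ∘ Πᵀ = E` then `(A∘E∘(Πᵀ∘A∘Π))(x,z)(inr m, inr m′) = (A∘E∘A)(x,z)(inr m, inr m′)`. -/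
theorem mm_mixed_eq_straight (hA : Spr A) (hE : Spr E) (hP : Spr (piKBm ρ N)) (hPt : Spr (trK (piKBm ρ N)))
    (hEr : comp E (trK (piKBm ρ N)) = E) (x z : Fin (d + 1) → ℤ) (m m' : Fin (d + 1)) :
    comp (comp A E) (coDressKBmAt ρ N A) x z (Sum.inr m) (Sum.inr m') = comp (comp A E) A x z (Sum.inr m) (Sum.inr m') := by
  have hAE : Spr (comp A E) := spr_comp hA hE
  have hPA : Spr (comp (trK (piKBm ρ N)) A) := spr_comp hPt hA
  rw [coDressKBmAt_eq, comp_assoc_tame hAE.tame hPA.tame hP.tame, comp_piKBm_inr,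
    comp_assoc_tame hAE.tame hPt.tame hA.tame, ← comp_assoc_tame hA.tame hE.tame hPt.tame, hEr]

/-- [folklore] **PURE = STRAIGHT**: if `Π ∘ E = E` and `E ∘ Πᵀ = E` then `((Πᵀ∘A∘Π)∘E∘(Πᵀ∘A∘Π))(x,z)(inr m, inr m′) = (A∘E∘A)(x,z)(inr m, inr m′)`. -/
theorem mm_pure_eq_straight (hA : Spr A) (hE : Spr E) (hP : Spr (piKBm ρ N)) (hPt : Spr (trK (piKBm ρ N)))
    (hEl : comp (piKBm ρ N) E = E) (hEr : comp E (trK (piKBm ρ N)) = E) (x z : Fin (d + 1) → ℤ) (m m' : Fin (d + 1)) :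
    comp (comp (coDressKBmAt ρ N A) E) (coDressKBmAt ρ N A) x z (Sum.inr m) (Sum.inr m')
      = comp (comp A E) A x z (Sum.inr m) (Sum.inr m') := by
  have hAE : Spr (comp A E) := spr_comp hA hE
  have hPA : Spr (comp (trK (piKBm ρ N)) A) := spr_comp hPt hA
  have hPAE : Spr (comp (comp (trK (piKBm ρ N)) A) E) := spr_comp hPA hE
  -- G∘E = (Πᵀ∘A)∘E
  have h1 : comp (coDressKBmAt ρ N A) E = comp (comp (trK (piKBm ρ N)) A) E := by
    rw [coDressKBmAt_eq, ← comp_assoc_tame hPA.tame hP.tame hE.tame, hEl]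
  rw [h1, coDressKBmAt_eq, comp_assoc_tame hPAE.tame hPA.tame hP.tame, comp_piKBm_inr,
    comp_assoc_tame hPAE.tame hPt.tame hA.tame, ← comp_assoc_tame hPA.tame hE.tame hPt.tame, hEr,
    ← comp_assoc_tame hPt.tame hA.tame hE.tame, ← comp_assoc_tame hPt.tame hAE.tame hA.tame, comp_trK_piKBm_inr]

/-- [folklore] **MIXED = PURE** on the multiplier block (hence on `colM`). -/
theorem colM_mixed_eq_pure [NeZero N] (hA : Spr A) (hE : Spr E) (hP : Spr (piKBm ρ N)) (hPt : Spr (trK (piKBm ρ N)))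
    (hEl : comp (piKBm ρ N) E = E) (hEr : comp E (trK (piKBm ρ N)) = E) (μ : Fin (d + 1)) (y : Fin (d + 1) → ℤ)
    (ρ' : Fin (d + 1)) (w : Fin (d + 1) → ℤ) :
    colM (comp (comp A E) (coDressKBmAt ρ N A)) N μ y ρ' w
      = colM (comp (comp (coDressKBmAt ρ N A) E) (coDressKBmAt ρ N A)) N μ y ρ' w := by
  simp only [colM]
  rw [mm_mixed_eq_straight hA hE hP hPt hEr, mm_pure_eq_straight hA hE hP hPt hEl hEr]

end Generic

/-! ## §2 The literal Λ-slot of `SrecAt (j+1)`: straight `KInvStep Lc (j+1)` coefficients, vertex through `G_{j+1}` -/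

section WallSucc

variable {Lc : ℕ} [NeZero Lc] {r : Fin (d + 1) → ℕ}

/-- [folklore] **THE MULTIPLIER COLUMN OF THE MIXED SANDWICH** `KInvStep_{j+1} ∘ E2_{j+1} ∘ G_{j+1}`:
`= −(wVH (j+1))⁻¹ · colM G_{j+1}` (blindness `comp_E2_trK_piKBm`/`comp_piKBm_E2` + part 2's `colM_sandwich_E2`). -/
theorem colM_mixed_sandwich_E2 (hr : r ∈ box (d + 1) Lc) (j : ℕ) (μ : Fin (d + 1)) (y : Fin (d + 1) → ℤ) (ρ' : Fin (d + 1))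
    (w : Fin (d + 1) → ℤ) :
    colM (comp (comp (KInvStep (d := d) Lc (j + 1)) (E2 d Lc (j + 1))) (coDressKBmAt (toSite r) Lc (KInvStep (d := d) Lc (j + 1)))) Lc μ y ρ' w
      = -(wVH d Lc (j + 1))⁻¹ * colM (coDressKBmAt (toSite r) Lc (KInvStep (d := d) Lc (j + 1))) Lc μ y ρ' w := by
  have hLc : 1 ≤ Lc := one_le_of_neZero Lc
  obtain ⟨δA, CA, hδA, _, hAd⟩ := decays_KInvStep (d := d) (Lc := Lc) (j + 1)
  obtain ⟨δE, CE, hδE, _, hEd⟩ := decays_E2 (d := d) (Lc := Lc) (j + 1)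
  rw [colM_mixed_eq_pure ⟨CA, δA, hδA, hAd⟩ ⟨CE, δE, hδE, hEd⟩ (spr_piKBm hLc hr) (spr_trK_piKBm hLc hr) (comp_piKBm_E2 hr (j + 1))
    (comp_E2_trK_piKBm hr (j + 1)), colM_sandwich_E2 hr j]

/-- [folklore] **THE LITERAL Λ-SLOT OF `SrecAt (j+1)` FOLDS TO THE MULTIPLIER-COLUMN VERTEX**: for `G := G_{j+1}` and every bounded coarse-bond
table `Q`, `vertexOfK G Lc (κ u ↦ c • SLam Lc (lamCoeffK (KInvStep Lc (j+1)) (E2 (j+1)) Lc) Q κ u) μ y = (c / wVH (j+1)) • vertexOfM G Lc Q μ y`. -/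
theorem vertexOfK_lagrangePiece_literal_eq_vertexOfM (hr : r ∈ box (d + 1) Lc) (j : ℕ)
    {Q : Fin (d + 1) → (Fin (d + 1) → ℤ) → MKer (d + 1) (Fib d)} {B : ℝ} (hQ : ∀ ρ' w x z a b, |Q ρ' w x z a b| ≤ B) (c : ℝ)
    (μ : Fin (d + 1)) (y : Fin (d + 1) → ℤ) :
    vertexOfK (coDressKBmAt (toSite r) Lc (KInvStep (d := d) Lc (j + 1))) Lc
        (fun κ u => c • SLam Lc (lamCoeffK (KInvStep (d := d) Lc (j + 1)) (E2 d Lc (j + 1)) Lc) Q κ u) μ y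
      = (c / wVH d Lc (j + 1)) • vertexOfM (coDressKBmAt (toSite r) Lc (KInvStep (d := d) Lc (j + 1))) Lc Q μ y := by
  have hG := decays_coDressKBmAt_KInvStep (d := d) hr (j + 1)
  have hAE : ∃ δ C : ℝ, 0 < δ ∧ 0 ≤ C ∧ Decays (comp (KInvStep (d := d) Lc (j + 1)) (E2 d Lc (j + 1))) C δ := by
    obtain ⟨δ₁, C₁, hδ₁, hC₁, h₁⟩ := decays_KInvStep (d := d) (Lc := Lc) (j + 1)
    obtain ⟨δ₂, C₂, hδ₂, hC₂, h₂⟩ := decays_E2 (d := d) (Lc := Lc) (j + 1)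
    have h₁' : Decays (KInvStep (d := d) Lc (j + 1)) C₁ (min δ₁ δ₂) := decays_mono h₁ hC₁ le_rfl (min_le_left _ _)
    have h₂' : Decays (E2 d Lc (j + 1)) C₂ (min δ₁ δ₂) := decays_mono h₂ hC₂ le_rfl (min_le_right _ _)
    have hm : 0 < min δ₁ δ₂ := lt_min hδ₁ hδ₂
    exact ⟨min δ₁ δ₂ / 2, _, half_pos hm, (decays_comp h₁' h₂' (half_pos hm).le (half_lt_self hm)).nonneg (Sum.inl 0),
      decays_comp h₁' h₂' (half_pos hm).le (half_lt_self hm)⟩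
  rw [vertexOfK_smul_SLam_lamCoeffK (N := Lc) hG hAE (fun v u h ν => LagrangeFold.E2_inr_col Lc (j + 1) v u h ν) hQ c μ y]
  have hv : vertexOfM (comp (comp (KInvStep (d := d) Lc (j + 1)) (E2 d Lc (j + 1)))
        (coDressKBmAt (toSite r) Lc (KInvStep (d := d) Lc (j + 1)))) Lc Q μ y
      = -((wVH d Lc (j + 1))⁻¹ • vertexOfM (coDressKBmAt (toSite r) Lc (KInvStep (d := d) Lc (j + 1))) Lc Q μ y) := by
    funext x z a b
    simp only [vertexOfM, cwsum_apply, Pi.neg_apply, Pi.smul_apply, smul_eq_mul, Finset.mul_sum, ← Finset.sum_neg_distrib]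
    refine Finset.sum_congr rfl fun ρ' _ => ?_
    rw [← tsum_mul_left, ← tsum_neg]
    refine tsum_congr fun w => ?_
    rw [colM_mixed_sandwich_E2 hr j μ y ρ' w]
    ring
  rw [hv, smul_neg, neg_neg, smul_smul, div_eq_mul_inv]

/-- [folklore] **ORDER-ONE CONSISTENCY OF THE Λ-SECTOR FOR `SrecAt (j+1)` AS ADOPTED**: with weight `cΛ·wΛ (j+1)` and `Q := hessFFAt` (given a
uniform entry bound), the literal Lagrange piece of `WardLocusRecursive.SrecAt … (j+1)` read through `G_{j+1}` IS
`vertexOfM G_{j+1} Lc (M1At d Lc (toSite r) cΛ (j+1))`. -/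
theorem vertexOfK_lagrangePiece_literal_eq_M1At (hr : r ∈ box (d + 1) Lc) (j : ℕ) (cΛ : ℝ) {B : ℝ}
    (hQ : ∀ ρ' w x z a b, |hessFFAt (toSite r) Lc ρ' w x z a b| ≤ B) (μ : Fin (d + 1)) (y : Fin (d + 1) → ℤ) :
    vertexOfK (coDressKBmAt (toSite r) Lc (KInvStep (d := d) Lc (j + 1))) Lc
        (fun κ u => (cΛ * wΛ d Lc (j + 1)) •
          SLam Lc (lamCoeffK (KInvStep (d := d) Lc (j + 1)) (E2 d Lc (j + 1)) Lc) (hessFFAt (toSite r) Lc) κ u) μ y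
      = vertexOfM (coDressKBmAt (toSite r) Lc (KInvStep (d := d) Lc (j + 1))) Lc (M1At d Lc (toSite r) cΛ (j + 1)) μ y := by
  rw [vertexOfK_lagrangePiece_literal_eq_vertexOfM hr j hQ _ μ y]
  have hw : wVH d Lc (j + 1) ≠ 0 := wVH_ne_zero (j + 1)
  have hc : cΛ * wΛ d Lc (j + 1) / wVH d Lc (j + 1) = cΛ * wM1 d Lc (j + 1) := by
    rw [wΛ_eq_wM1_mul_wVH]; field_simp
  rw [hc]
  funext x z a b
  simp only [Pi.smul_apply, smul_eq_mul, vertexOfM, cwsum_apply, M1At, Finset.mul_sum]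
  refine Finset.sum_congr rfl fun ρ' _ => ?_
  rw [← tsum_mul_left]
  exact tsum_congr fun w => by ring

end WallSucc

/-! ## §3 The literal Λ-slot of `S0NAt`: `lamCoeffOf (KInv Lc) Lc`, vertex through `G_0` -/

section WallZero

variable [NeZero N] {r : Fin (d + 1) → ℕ}

/-- [folklore] The field block of the rooted bordered Hessian (as a kernel `H₀`, other blocks zero) is RIGHT-BLIND to the dressing:
`H₀ ∘ Πᵀ = H₀` (the `ff` block of `BorderedHessianBlind.comp_bhK_trK_piKBm`; `bhKAt_ff = bhK_ff`). -/
theorem comp_ffBhKAt_trK_piKBm (hr : r ∈ box (d + 1) N) (H₀ : MKer (d + 1) (Fib d))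
    (hff : ∀ x z κ l, H₀ x z (Sum.inl κ) (Sum.inl l) = bhKAt d (toSite r) N x z (Sum.inl κ) (Sum.inl l))
    (hfm : ∀ x z κ ν, H₀ x z (Sum.inl κ) (Sum.inr ν) = 0) (hmf : ∀ x z ν l, H₀ x z (Sum.inr ν) (Sum.inl l) = 0)
    (hmm : ∀ x z ν ν', H₀ x z (Sum.inr ν) (Sum.inr ν') = 0) :
    comp H₀ (trK (piKBm (toSite r) N)) = H₀ := by
  have hB := comp_bhK_trK_piKBm (d := d) hr
  funext x z a b
  rcases a with κ | ν
  · rcases b with l | ν'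
    · have h := congrFun (congrFun (congrFun (congrFun hB x) z) (Sum.inl κ)) (Sum.inl l)
      unfold ExpKernelCalculus.comp at h ⊢
      rw [hff, bhKAt_inl_inl, ← h]
      refine tsum_congr fun u => ?_
      rw [Fintype.sum_sum_type, Fintype.sum_sum_type]
      simp only [trK_apply, piKBm_inl_inr, hff, bhKAt_inl_inl, mul_zero, Finset.sum_const_zero]
    · unfold ExpKernelCalculus.comp
      rw [hfm]
      simp only [Fintype.sum_sum_type, trK_apply, piKBm_inr_inl, Finset.sum_const_zero, hfm, zero_mul, add_zero, mul_zero, tsum_zero]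
  · unfold ExpKernelCalculus.comp
    rcases b with l | ν'
    · rw [hmf]; simp only [Fintype.sum_sum_type, hmf, hmm, zero_mul, Finset.sum_const_zero, add_zero, tsum_zero]
    · rw [hmm]; simp only [Fintype.sum_sum_type, hmf, hmm, zero_mul, Finset.sum_const_zero, add_zero, tsum_zero]

/-- [folklore] LEFT blindness of the field block: `Π ∘ H₀ = H₀` (the `ff` block of `BorderedHessianBlind.comp_piKBm_bhK`). -/
theorem comp_piKBm_ffBhKAt (hr : r ∈ box (d + 1) N) (H₀ : MKer (d + 1) (Fib d))
    (hff : ∀ x z κ l, H₀ x z (Sum.inl κ) (Sum.inl l) = bhKAt d (toSite r) N x z (Sum.inl κ) (Sum.inl l))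
    (hfm : ∀ x z κ ν, H₀ x z (Sum.inl κ) (Sum.inr ν) = 0) (hmf : ∀ x z ν l, H₀ x z (Sum.inr ν) (Sum.inl l) = 0)
    (hmm : ∀ x z ν ν', H₀ x z (Sum.inr ν) (Sum.inr ν') = 0) :
    comp (piKBm (toSite r) N) H₀ = H₀ := by
  have hB := comp_piKBm_bhK (d := d) hr
  funext x z a b
  rcases b with l | ν'
  · rcases a with κ | ν
    · have h := congrFun (congrFun (congrFun (congrFun hB x) z) (Sum.inl κ)) (Sum.inl l)
      unfold ExpKernelCalculus.comp at h ⊢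
      rw [hff, bhKAt_inl_inl, ← h]
      refine tsum_congr fun u => ?_
      rw [Fintype.sum_sum_type, Fintype.sum_sum_type]
      simp only [piKBm_inl_inr, hff, bhKAt_inl_inl, zero_mul, Finset.sum_const_zero]
    · unfold ExpKernelCalculus.comp
      rw [hmf]
      simp only [Fintype.sum_sum_type, piKBm_inr_inl, Finset.sum_const_zero, hmf, mul_zero, zero_mul, add_zero, tsum_zero]
  · unfold ExpKernelCalculus.comp
    rcases a with κ | ν
    · rw [hfm]; simp only [Fintype.sum_sum_type, hfm, hmm, mul_zero, Finset.sum_const_zero, add_zero, tsum_zero]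
    · rw [hmm]; simp only [Fintype.sum_sum_type, hfm, hmm, mul_zero, Finset.sum_const_zero, add_zero, tsum_zero]

/-- [folklore] **THE LITERAL LEVEL-0 Λ-SLOT FOLDS TO THE MULTIPLIER-COLUMN VERTEX**: for `G₀ := coDressKBmAt (toSite r) N (KInvStep N 0)` and every
bounded coarse-bond table `Q`, `vertexOfK G₀ N (κ u ↦ c • SLam N (lamCoeffOf (KInv N) N) Q κ u) μ y = c • vertexOfM G₀ N Q μ y`. -/
theorem vertexOfK_lagrangePiece_literal_zero_eq_vertexOfM (hr : r ∈ box (d + 1) N)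
    {Q : Fin (d + 1) → (Fin (d + 1) → ℤ) → MKer (d + 1) (Fib d)} {B : ℝ} (hQ : ∀ ρ' w x z a b, |Q ρ' w x z a b| ≤ B) (c : ℝ)
    (μ : Fin (d + 1)) (y : Fin (d + 1) → ℤ) :
    vertexOfK (coDressKBmAt (toSite r) N (KInvStep (d := d) N 0)) N
        (fun κ u => c • SLam N (lamCoeffOf (KInv (N := N) (d := d)) N) Q κ u) μ y
      = c • vertexOfM (coDressKBmAt (toSite r) N (KInvStep (d := d) N 0)) N Q μ y := by
  have hN : 1 ≤ N := one_le_of_neZero N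
  set A := KInvStep (d := d) N 0 with hAdef
  set G := coDressKBmAt (toSite r) N A with hGdef
  set H₀ : MKer (d + 1) (Fib d) := fun x z a b => match a, b with
    | Sum.inl κ, Sum.inl l => bhKAt d (toSite r) N x z (Sum.inl κ) (Sum.inl l)
    | _, _ => 0 with hH
  have hff : ∀ x z κ l, H₀ x z (Sum.inl κ) (Sum.inl l) = bhKAt d (toSite r) N x z (Sum.inl κ) (Sum.inl l) := fun _ _ _ _ => rfl
  have hfm : ∀ x z κ ν, H₀ x z (Sum.inl κ) (Sum.inr ν) = 0 := fun _ _ _ _ => rfl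
  have hmf : ∀ x z ν l, H₀ x z (Sum.inr ν) (Sum.inl l) = 0 := fun _ _ _ _ => rfl
  have hmm : ∀ x z ν ν', H₀ x z (Sum.inr ν) (Sum.inr ν') = 0 := fun _ _ _ _ => rfl
  have hcoef : lamCoeffOf (KInv (N := N) (d := d)) N = lamCoeffK A H₀ N := by
    funext μ' y' κ' u'
    rw [hAdef, KInvStep_zero_eq]
    exact lamCoeffOf_eq_lamCoeffK (toSite r) _ H₀ hff hmf μ' y' κ' u'
  have hA := decays_KInvStep (d := d) (Lc := N) 0
  have hG := decays_coDressKBmAt_KInvStep (d := d) hr 0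
  have hH₀ : ∃ δ C : ℝ, 0 < δ ∧ 0 ≤ C ∧ Decays H₀ C δ := by
    have hMd := decays_bhKAt (d := d) hN hr (show (0 : ℝ) ≤ 1 from zero_le_one)
    refine ⟨1, _, one_pos, hMd.nonneg (Sum.inl 0), fun x z a b => ?_⟩
    rcases a with κ | ν <;> rcases b with l | ν'
    · exact hMd x z (Sum.inl κ) (Sum.inl l)
    all_goals
      simp only [hH, abs_zero]
      exact (abs_nonneg _).trans (hMd x z (Sum.inl 0) (Sum.inl 0))
  have hAE : ∃ δ C : ℝ, 0 < δ ∧ 0 ≤ C ∧ Decays (comp A H₀) C δ := by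
    obtain ⟨δ₁, C₁, hδ₁, hC₁, h₁⟩ := hA
    obtain ⟨δ₂, C₂, hδ₂, hC₂, h₂⟩ := hH₀
    have h₁' : Decays A C₁ (min δ₁ δ₂) := decays_mono h₁ hC₁ le_rfl (min_le_left _ _)
    have h₂' : Decays H₀ C₂ (min δ₁ δ₂) := decays_mono h₂ hC₂ le_rfl (min_le_right _ _)
    have hm : 0 < min δ₁ δ₂ := lt_min hδ₁ hδ₂
    exact ⟨min δ₁ δ₂ / 2, _, half_pos hm, (decays_comp h₁' h₂' (half_pos hm).le (half_lt_self hm)).nonneg (Sum.inl 0),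
      decays_comp h₁' h₂' (half_pos hm).le (half_lt_self hm)⟩
  have hE : ∀ v u (h : Fib d) (ν : Fin (d + 1)), H₀ v u h (Sum.inr ν) = 0 := fun v u h ν => by cases h <;> rfl
  rw [hcoef, vertexOfK_smul_SLam_lamCoeffK (N := N) hG hAE hE hQ c μ y]
  -- the mixed sandwich's multiplier column equals the pure one's, which is minus that of `G`
  obtain ⟨δA, CA, hδA, _, hAd⟩ := hA
  obtain ⟨δH, CH, hδH, _, hHd⟩ := hH₀
  have hmix : ∀ ρ' w, colM (comp (comp A H₀) G) N μ y ρ' w = -colM G N μ y ρ' w := by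
    intro ρ' w
    rw [hGdef, colM_mixed_eq_pure ⟨CA, δA, hδA, hAd⟩ ⟨CH, δH, hδH, hHd⟩ (spr_piKBm hN hr) (spr_trK_piKBm hN hr)
      (comp_piKBm_ffBhKAt hr H₀ hff hfm hmf hmm) (comp_ffBhKAt_trK_piKBm hr H₀ hff hfm hmf hmm), hAdef, hH]
    exact colM_sandwich_zero hr μ y ρ' w
  have hv : vertexOfM (comp (comp A H₀) G) N Q μ y = -vertexOfM G N Q μ y := by
    funext x z a b
    simp only [vertexOfM, cwsum_apply, Pi.neg_apply, ← Finset.sum_neg_distrib, ← tsum_neg]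
    refine Finset.sum_congr rfl fun ρ' _ => tsum_congr fun w => ?_
    rw [hmix ρ' w]
    ring
  rw [hv, smul_neg, neg_neg]

/-- [folklore] **ORDER-ONE CONSISTENCY OF THE Λ-SECTOR FOR `S0NAt` AS ADOPTED**: with weight `cΛ` and `Q := hessFFAt (toSite r) N` (given a
uniform entry bound), `vertexOfK G₀ N (κ u ↦ cΛ • SLam N (lamCoeffOf (KInv N) N) (hessFFAt (toSite r) N) κ u) μ y =
vertexOfM G₀ N (M1At d N (toSite r) cΛ 0) μ y`. -/
theorem vertexOfK_lagrangePiece_literal_zero_eq_M1At (hr : r ∈ box (d + 1) N) (cΛ : ℝ) {B : ℝ}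
    (hQ : ∀ ρ' w x z a b, |hessFFAt (toSite r) N ρ' w x z a b| ≤ B) (μ : Fin (d + 1)) (y : Fin (d + 1) → ℤ) :
    vertexOfK (coDressKBmAt (toSite r) N (KInvStep (d := d) N 0)) N
        (fun κ u => cΛ • SLam N (lamCoeffOf (KInv (N := N) (d := d)) N) (hessFFAt (toSite r) N) κ u) μ y
      = vertexOfM (coDressKBmAt (toSite r) N (KInvStep (d := d) N 0)) N (M1At d N (toSite r) cΛ 0) μ y := by
  rw [vertexOfK_lagrangePiece_literal_zero_eq_vertexOfM hr hQ cΛ μ y]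
  funext x z a b
  simp only [Pi.smul_apply, smul_eq_mul, vertexOfM, cwsum_apply, M1At, wM1_zero, mul_one, Finset.mul_sum]
  refine Finset.sum_congr rfl fun ρ' _ => ?_
  rw [← tsum_mul_left]
  exact tsum_congr fun w => by ring

end WallZero

end Summit.QuantumFields.BalabanUV.Beta.LagrangeFoldLiteral

end
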